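import Summits.Schanuel.Schanuel.Theses.RoyCriterion

/-!
# Sketch — crux idea `liouville-window-ladder` for crux `RoyThesisTyped` (stmt-Schanuel-0463)

First lemmas of the line, stated over existing declarations
(`Literature.NumberTheory.Transcendental.{royD, RoyAdmissible, RoyHypothesis, RoyCriterion}`).
Nothing here is proposed to the gate; `lean check` only certifies that the statements elaborate and
that the bookkeeping compositions are kernel-checked.
-/

noncomputable section

namespace Summit.Schanuel.Schanuel.Cruxes.RoyThesisTyped.LiouvilleWindowLadder

open Literature.NumberTheory.Transcendental
open scoped BigOperators

/-- EXACT Roy data: the hypothesis of Roy's Conjecture 2 with `= 0` in place of `≤ exp (-N^u)`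
(and no height bound, which only weakens the statement `NoExactRoyData` below). -/
def RoyExactData {l : ℕ} (y α : Fin l → ℂ) (s₀ s₁ t₀ t₁ : ℝ) : Prop :=
  ∀ᶠ N : ℕ in Filter.atTop, ∃ P : MvPolynomial (Fin 2) ℤ, P ≠ 0 ∧
    (P.degreeOf 0 : ℝ) ≤ (N : ℝ) ^ t₀ ∧ (P.degreeOf 1 : ℝ) ≤ (N : ℝ) ^ t₁ ∧
    ∀ (k : ℕ) (m : Fin l → ℕ), (k : ℝ) ≤ (N : ℝ) ^ s₀ → (∀ j, (m j : ℝ) ≤ (N : ℝ) ^ s₁) →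
      MvPolynomial.aeval ![∑ j, (m j : ℂ) * y j, ∏ j, α j ^ m j] (royD^[k] P) = 0

/-- **First lemma (C2, `NoExactRoyData`).** In the LEFT half of Roy's window (1),
`max{1,t₀,2t₁} < min{s₀,2s₁}` (no `u` involved), exact vanishing of the Roy data is impossible at
every point whose additive coordinates are `ℚ`-linearly independent (`l ≥ 1`). Intended proof:
Philippon's multiplicity estimate on `𝔾ₐ × 𝔾ₘ ⊂ ℙ¹ × ℙ¹` (tree: `Philippon1986_GaGm_holds`,
case `m = 1`, `W = ℂ·(1,1)`, `Σ` = half-box, `T = ⌊(N^{s₀}-1)/2⌋`): each of the three proper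
connected subgroups `{e}`, `𝔾ₐ × 1`, `0 × 𝔾ₘ` yields an inequality that fails for large `N`
(`s₀ + l·s₁ > t₀ + t₁`, `s₀ > t₁`, `s₀ + l·s₁ > t₀` respectively). -/
def NoExactRoyData : Prop :=
  ∀ (l : ℕ), 1 ≤ l → ∀ (y α : Fin l → ℂ), LinearIndependent ℚ y → (∀ j, α j ≠ 0) →
    ∀ (s₀ s₁ t₀ t₁ : ℝ), 0 < t₀ → 0 < t₁ → max 1 (max t₀ (2 * t₁)) < min s₀ (2 * s₁) →
      ¬ RoyExactData y α s₀ s₁ t₀ t₁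

/-- **Liouville step (C1).** At an algebraic point the Roy-small values are exact zeros for all
large `N`: the additive Liouville cost of `Dᵏ P_N(m·y, α^m)` has exponents `{1, s₀+ε, t₀+ε, s₁+t₁}`,
all `< u` by `RoyAdmissible` (this is exactly the lower constraint `max{s₀, s₁+t₁} < u` of (1)). -/
def RoyLiouvilleStep : Prop :=
  ∀ (l : ℕ) (y α : Fin l → ℂ), (∀ j, IsAlgebraic ℚ (y j)) → (∀ j, IsAlgebraic ℚ (α j)) →
    (∀ j, α j ≠ 0) → ∀ (s₀ s₁ t₀ t₁ u : ℝ), RoyAdmissible s₀ s₁ t₀ t₁ u →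
      RoyHypothesis y α s₀ s₁ t₀ t₁ u → RoyExactData y α s₀ s₁ t₀ t₁

/-- **Rung 0 = the algebraic slice of the crux, every rank `l ≥ 1`** (direct: no `Roy2001_iff`,
no Hermite–Lindemann / Lindemann–Weierstrass). -/
def AlgebraicSlice : Prop :=
  ∀ (l : ℕ), 1 ≤ l → ∀ (y α : Fin l → ℂ), LinearIndependent ℚ y → (∀ j, α j ≠ 0) →
    (∀ j, IsAlgebraic ℚ (y j)) → (∀ j, IsAlgebraic ℚ (α j)) →
    ∀ (s₀ s₁ t₀ t₁ u : ℝ), RoyAdmissible s₀ s₁ t₀ t₁ u → ¬ RoyHypothesis y α s₀ s₁ t₀ t₁ u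

/-- Kernel-checked composition: (C1) + (C2) ⟹ rung 0. -/
theorem algebraicSlice_of (h₁ : RoyLiouvilleStep) (h₂ : NoExactRoyData) : AlgebraicSlice := by
  intro l hl y α hy hα hya hαa s₀ s₁ t₀ t₁ u hadm hhyp
  obtain ⟨hs₀, hs₁, ht₀, ht₁, hu, hwin, hlow, hup⟩ := hadm
  exact h₂ l hl y α hy hα s₀ s₁ t₀ t₁ ht₀ ht₁ hwin (h₁ l y α hya hαa hα s₀ s₁ t₀ t₁ u
    ⟨hs₀, hs₁, ht₀, ht₁, hu, hwin, hlow, hup⟩ hhyp)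

/-- **Rung `r` of the ladder for rank `l`**: no Roy point of transcendence degree exactly `r`.
Rung 0 is `AlgebraicSlice`; for `1 ≤ r < l` rung `(l, r)` is, through Roy's Theorem 1
(`Roy2001_prop3_holds`), the statement "no `ℚ`-linearly independent `y` of rank `l` with
`trdeg ℚ(y, e^y) = r`" — Schanuel's `(l, r)` case, open from `(2, 1)` = `(e, π)` on. -/
def Rung (l r : ℕ) : Prop :=
  ∀ (y α : Fin l → ℂ), LinearIndependent ℚ y → (∀ j, α j ≠ 0) →
    Algebra.trdeg ℚ ↥(IntermediateField.adjoin ℚ (Set.range y ∪ Set.range α)) = r →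
    ∀ (s₀ s₁ t₀ t₁ u : ℝ), RoyAdmissible s₀ s₁ t₀ t₁ u → ¬ RoyHypothesis y α s₀ s₁ t₀ t₁ u

/-- Kernel-checked ladder principle: the rungs `r < l` give Roy's criterion in rank `l`
(the transcendence degree of a field generated by `2l` elements is a natural number `≤ 2l`, so
`¬ (l ≤ trdeg)` pins it to some `r < l`). -/
theorem royCriterion_of_rungs (l : ℕ) (h : ∀ r, r < l → Rung l r) : RoyCriterion l := by
  intro y α hy hα s₀ s₁ t₀ t₁ u hadm hhyp
  by_contra hlt
  push_neg at hlt
  -- `trdeg < l < ℵ₀`, so it is a natural number `r < l`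
  obtain ⟨r, hr⟩ := Cardinal.lt_aleph0.1 (lt_trans hlt (Cardinal.nat_lt_aleph0 l))
  have hrl : r < l := by
    have := hlt
    rw [hr] at this
    exact_mod_cast this
  exact h r hrl y α hy hα hr s₀ s₁ t₀ t₁ u hadm hhyp

/-- The crux from the full ladder (all ranks, all rungs). -/
theorem royThesisTyped_of_ladder (h : ∀ l r, r < l → Rung l r) :
    Summit.Schanuel.Schanuel.Theses.RoyCriterion.RoyThesisTyped :=
  fun l => royCriterion_of_rungs l (fun r hr => h l r hr)

/-- Rung 0 from the algebraic slice: a point of transcendence degree `0` has all coordinates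
algebraic. (Bookkeeping over Mathlib's `trdeg`; stated, proof deferred to the line.) -/
def RungZeroOfSlice : Prop := AlgebraicSlice → ∀ l, 1 ≤ l → Rung l 0


/-! ### The ladder is triangular: only the diagonal rungs `(l, l-1)` are load-bearing -/

/-- **Sub-box restriction (native to Roy's format; bookkeeping, provable now):** the Roy hypothesis
for `(y, α)` of rank `l` restricts to every initial sub-family (extend `m` by zeros: the sub-box of
the box is a box, `∑_{j<l'} m_j y_j` and `∏_{j<l'} α_j^{m_j}` are the same point). -/
def RoyHypothesisRestricts : Prop :=
  ∀ (l' l : ℕ) (hle : l' ≤ l) (y α : Fin l → ℂ) (s₀ s₁ t₀ t₁ u : ℝ),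
    RoyHypothesis y α s₀ s₁ t₀ t₁ u →
      RoyHypothesis (y ∘ Fin.castLE hle) (α ∘ Fin.castLE hle) s₀ s₁ t₀ t₁ u

/-- Off-diagonal rungs come for free from the lower rank: if `RoyCriterion l'` holds for some
`l' < l` with `r < l'`... precisely, `Rung l r` for `r + 2 ≤ l` follows from `RoyCriterion (l-1)`
by restricting to the first `l-1` generators (transcendence degree can only drop). Stated as a
`Prop` (the proof is `RoyHypothesisRestricts` + `trdeg` monotonicity under `adjoin.mono` +
`LinearIndependent.comp`). -/
def OffDiagonalFromLowerRank : Prop :=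
  ∀ (l r : ℕ), r + 2 ≤ l → RoyCriterion (l - 1) → Rung l r

/-- **Triangular ladder principle (kernel-checked modulo the two bookkeeping Props):** the crux is
equivalent to the conjunction of the DIAGONAL rungs `Rung l (l-1)`, `l ≥ 1` — "no essential Roy
counterexample": a rank-`l` Roy point of transcendence degree exactly `l - 1`. `Rung 1 0` is the
rank-one algebraic slice (provable now); `Rung 2 1 ⟺ SchanuelTwo` (route crux stmt-Schanuel-0069);
`Rung l (l-1)` for `l ≥ 3` are the summit's "uniform second degree"-type statements read upward. -/
theorem royThesisTyped_of_diagonal (hoff : OffDiagonalFromLowerRank)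
    (hdiag : ∀ l, 1 ≤ l → Rung l (l - 1)) :
    Summit.Schanuel.Schanuel.Theses.RoyCriterion.RoyThesisTyped := by
  -- strong induction on the rank
  have key : ∀ l, RoyCriterion l := by
    intro l
    induction l using Nat.strong_induction_on with
    | _ l ih =>
      rcases Nat.eq_zero_or_pos l with rfl | hl
      · exact royCriterion_zero
      · refine royCriterion_of_rungs l (fun r hr => ?_)
        by_cases hdr : r + 1 = l
        · have : r = l - 1 := by omega
          subst this
          exact hdiag l hl
        · have h2 : r + 2 ≤ l := by omega
          exact hoff l r h2 (ih (l - 1) (by omega))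
  exact fun l => key l

/-- **The criterion-cost wall inside window (1)** (obstruction recorded as arithmetic of exponents;
all provable by `linarith` from `RoyAdmissible`): the smallness exponent `u` is below every
product-cost exponent a classical criterion would need at transcendence degree `≥ 1`. -/
theorem window_below_product_costs {s₀ s₁ t₀ t₁ u : ℝ} (h : RoyAdmissible s₀ s₁ t₀ t₁ u) :
    u < 1 + s₁ + t₁ ∧ u < s₀ + s₁ + t₁ ∧ u < 1 + t₀ ∧ u < 2 := by
  obtain ⟨hs₀, hs₁, ht₀, ht₁, hu, hwin, hlow, hup⟩ := h
  have h1 : (1 : ℝ) < s₀ := lt_of_le_of_lt (le_max_left _ _) (lt_of_lt_of_le hwin (min_le_left _ _))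
  have h2 : t₀ < s₀ := lt_of_le_of_lt ((le_max_left _ _).trans (le_max_right _ _))
    (lt_of_lt_of_le hwin (min_le_left _ _))
  have h3 : 2 * t₁ < s₀ := lt_of_le_of_lt ((le_max_right _ _).trans (le_max_right _ _))
    (lt_of_lt_of_le hwin (min_le_left _ _))
  have h4 : 2 * t₁ < 2 * s₁ := lt_of_le_of_lt ((le_max_right _ _).trans (le_max_right _ _))
    (lt_of_lt_of_le hwin (min_le_right _ _))
  have h5 : (1 : ℝ) < 2 * s₁ := lt_of_le_of_lt (le_max_left _ _) (lt_of_lt_of_le hwin (min_le_right _ _))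
  have h6 : s₀ < u := lt_of_le_of_lt (le_max_left _ _) hlow
  have h7 : s₁ + t₁ < u := lt_of_le_of_lt (le_max_right _ _) hlow
  refine ⟨by linarith, by linarith, by nlinarith, by nlinarith⟩

/-- **Liouville affordability is exactly the lower edge of (1)**: the additive-cost exponents of a
Roy value at an algebraic point are all `< u`. -/
theorem window_above_liouville_costs {s₀ s₁ t₀ t₁ u : ℝ} (h : RoyAdmissible s₀ s₁ t₀ t₁ u) :
    1 < u ∧ s₀ < u ∧ t₀ < u ∧ s₁ + t₁ < u := by
  obtain ⟨hs₀, hs₁, ht₀, ht₁, hu, hwin, hlow, hup⟩ := h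
  have h1 : (1 : ℝ) < s₀ := lt_of_le_of_lt (le_max_left _ _) (lt_of_lt_of_le hwin (min_le_left _ _))
  have h2 : t₀ < s₀ := lt_of_le_of_lt ((le_max_left _ _).trans (le_max_right _ _))
    (lt_of_lt_of_le hwin (min_le_left _ _))
  have h6 : s₀ < u := lt_of_le_of_lt (le_max_left _ _) hlow
  have h7 : s₁ + t₁ < u := lt_of_le_of_lt (le_max_right _ _) hlow
  exact ⟨by linarith, h6, by linarith, h7⟩

end Summit.Schanuel.Schanuel.Cruxes.RoyThesisTyped.LiouvilleWindowLadder

end
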